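/-
Copyright (c) 2026. All rights reserved.
Released under Apache 2.0 license as described in the file LICENSE.
-/
import Literature.Probability.FitznerVanDerHofstad2017.NobleBoundsNClosedU
import Literature.Probability.FitznerVanDerHofstad2017.NobleBoundsNMidSOne
import HarnessLib

/-!
# NoBLE N-bounds — the ★-cells `(a, 2, ★)` and `(a, 1, ★)` of a middle junction (upper level closed)

The packages of the cells with lower exit class `a`, inner class `c ∈ {1, 2}` and a SPECIAL successor junction
(`a_{k+1} = ★`: the upper level `k + 1` is closed, its end is the pin `u_{k+1}`), against the `c` summand
`A^{κ,a,c,*}(u_k,w_k,t_k,z_k) · A^{c,0}(t_k,z_k,u_{k+1},u_{k+1})` of the first term of (5.4) read in column `0`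
at `w′ := u_{k+1}` (the closed section of the bordered block matrix): `c = 2`, `a ∈ {0,1,2}` and `c = 1`,
`a ∈ {1,2}`.  Twins of `nonempty_jPkg_midS_two_zero` / `nonempty_jPkg_midS_one_zero` with the closed-level
readings of `NobleBoundsNClosedU` (on a closed level with `t_k ≠ z_k` the canonical clause gives
`t_k, z_k ≠ u_{k+1}`, the facts the open case reads from the `F‴` clause).
[cite: FitznerVanDerHofstad2017, §6.1 (6.4), "Case b ≥ 2" (arXiv:1506.07977v2 pp. 58–59); §5.1 (5.4) (p. 48); (4.58), (4.62) (p. 41)]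
-/

namespace Literature.Probability.FitznerVanDerHofstad2017

open Literature.Barriers.CriticalPhenomena Literature.Probability.Percolation
open Literature.Probability.LatticeModels Literature.Combinatorics.SimpleGraph _root_.SimpleGraph
open _root_.MeasureTheory
open Literature.Probability.FitznerVanDerHofstad2017.NobleBlocks
open Literature.Probability.FitznerVanDerHofstad2017.NobleBlocks.LenIdx
open scoped ENNReal

variable {d : ℕ}

section Grouping

variable (M : ℕ) (x : Site d) (b : Fin (M + 2) → Site d × Site d) (w t z : Fin (M + 2) → Site d)
  (a : Fin (M + 2) → Fin 3 ⊕ Unit) (τ : Fin (M + 1) → Bool × Fin 3)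

/-- The grouping of term 1 obeys the (4.65) rule over a CLOSED upper level as well: its only cross-level letter
joins lower lines with the entry slots `0, 1`. [cite: FitznerVanDerHofstad2017, §4.4 (4.65) (arXiv:1506.07977v2 p. 43); (4.62) (p. 41)] -/
theorem glMidS1_entry_closedU (i : Fin (M + 1)) {u₀ : Unit} (ha' : a i.succ = Sum.inr u₀)
    (j j' : Fin 6) (hg : glMidS1 (.lo j) = glMidS1 (.up j')) :
    IsEntry (pieceViews M x b w t z a τ i.castSucc.succ).kd j' := by
  rw [pieceViews_mid_kd, ha']
  show (j' : ℕ) < 2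
  fin_cases j' <;> simp [glMidS1] at hg ⊢

end Grouping

section ClosedUFacts

variable {M : ℕ} {x : Site d} {b : Fin (M + 2) → Site d × Site d} {w t z : Fin (M + 2) → Site d}
  {a : Fin (M + 2) → Fin 3 ⊕ Unit} {c : Fin 3 ⊕ Unit} {τ : Fin (M + 1) → Bool × Fin 3}
  {ω : Fin (M + 3) → BondConfig (Site d)} {K₀ : Fin (M + 3) → Fin 6 → Set (Sym2 (Site d))}

/-- **The open sausage bond is its own witness** on a closed level `k + 1`: if `t_k ≠ z_k` and `(t_k, z_k)` is open
in `ω_{k+1}`, the witness of the sausage line (slot `1`) is `{(t_k, z_k)}`.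
[cite: FitznerVanDerHofstad2017, §6.1 proof of Lemma 5.2, Case b = 1 (arXiv:1506.07977v2 p. 59); §4.4 after (4.65) (p. 43); (4.62) (p. 41)] -/
theorem JFacts.tz_witness_closedU (h : JFacts M x b w t z a c τ ω K₀) (i : Fin (M + 1)) {u₀ : Unit}
    (ha' : a i.succ = Sum.inr u₀) (htz : t i.castSucc ≠ z i.castSucc)
    (hb : s(t i.castSucc, z i.castSucc) ∈ ω i.castSucc.succ) :
    K₀ i.castSucc.succ 1 = {s(t i.castSucc, z i.castSucc)} := by
  have h9 := h.conds.tzNF i.castSucc.succ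
  rw [pieceViews_closedU M x b w t z a τ i ha'] at h9
  exact h9 (fun h => by cases h) htz hb

end ClosedUFacts

section Packages

variable (p : unitInterval) (M : ℕ) (x : Site d) (b : Fin (M + 2) → Site d × Site d) (w t z : Fin (M + 2) → Site d)
  (a : Fin (M + 2) → Fin 3 ⊕ Unit) (c : Fin 3 ⊕ Unit) (τ : Fin (M + 1) → Bool × Fin 3)

/-- **Cells `(a, 2, ★)`, `a ∈ {0,1,2}`, of a middle junction `k = i₀ + 1 ≤ M` whose successor junction is
special** (upper level `k + 1` closed, either variant bit): a package with target the `c = 2` summand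
`A^{κ,a,2,*}(u_k,w_k,t_k,z_k) · A^{2,0}(t_k,z_k,u_{k+1},u_{k+1})` of the first term of (5.4) in the closed
section (`w′ := u_{k+1}`).  Inner class `2` upgrades the sausage line to `{t ←2→ z}`; the closed level's
canonical clause with `t_k ≠ z_k` gives `t_k ≠ u_{k+1}`, so `{t ←1→ u_{k+1}}`; the `A^{κ,a,2,*}` letter takes
the bond, the exit line of level `k` and the two entry lines of level `k + 1`, exactly as in the open case.
[cite: FitznerVanDerHofstad2017, §6.1 (6.4), "Case a = 0 / a = 1 / a ≥ 2", "Case b ≥ 2" (arXiv:1506.07977v2 pp. 58–59); §5.1 (5.4) (p. 48); (4.58), (4.62) (p. 41); App. B (pp. 74–75)] -/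
theorem nonempty_jPkg_closedU_two (i i₀ : Fin (M + 1)) (hk : i₀.succ = i.castSucc) (κ : Fin d × Bool)
    (hb : (b i.castSucc).2 = (b i.castSucc).1 + stepVec κ) (hc2 : (τ i).2 = 2)
    (a₀ : Fin 3) (ha : a i.castSucc = Sum.inl a₀) {u₀ : Unit} (ha' : a i.succ = Sum.inr u₀) :
    Nonempty (JPkg p (jctx M x b w t z a τ i.castSucc) (JFacts M x b w t z a c τ)
      (blockAiotaSt (Letters.perc d p) κ a₀ 2 (b i.castSucc).1 (w i.castSucc) (t i.castSucc) (z i.castSucc) *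
        blockA (Letters.perc d p) 2 0 (t i.castSucc) (z i.castSucc) (b i.succ).1 (b i.succ).1)) := by
  -- degenerate parameters: the piece is empty
  by_cases hP : t i.castSucc ≠ z i.castSucc ∧ t i.castSucc ≠ (b i.succ).1 ∧
      (b i.castSucc).1 ≠ t i.castSucc ∧ (b i.castSucc).1 ≠ z i.castSucc ∧
      (a₀ = 0 → w i.castSucc = (b i.castSucc).1) ∧ (a₀ = 1 → (zdGraph d).Adj (b i.castSucc).1 (w i.castSucc))
  swap
  · refine ⟨JPkg.vacuous p _ _ (fun ω K₀ hF => hP ?_) _⟩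
    have hv := hF.vac_closedU i ha'
    have htz := hF.t_ne_z_of_innerClass_ne_zero i (by rw [hc2]; decide)
    refine ⟨htz, (hF.ne_pin_closedU i ha' htz).2, fun h => hv (by simp [h]), fun h => hv (by simp [h]),
      fun h0 => hF.w_eq_of_exitClass_zero i.castSucc (ha.trans (by rw [h0])),
      fun h1 => (hF.exitClass_one i.castSucc (ha.trans (by rw [h1]))).2.2⟩
  obtain ⟨htz, hty, hut, huz, hw0, hw1⟩ := hP
  have huv : (b i.castSucc).1 ≠ (b i.castSucc).2 := by
    rw [hb]; exact (zdGraph_adj_iff_stepVec _ _ |>.2 ⟨κ, rfl⟩).ne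
  refine nonempty_jPkg_of_joint p i.castSucc glMidS1 true
    (midEv (event (eq 1) (b i.castSucc).1 (b i.castSucc).2) (event (ge 0) (b i.castSucc).2 (t i.castSucc))
      (event (ge 2) (t i.castSucc) (z i.castSucc)) (event (ge 1) (t i.castSucc) (b i.succ).1)
      (event (ge 0) (b i.succ).1 (z i.castSucc)) Set.univ (endX a₀ (b i.castSucc).1 (w i.castSucc) (z i.castSucc)))
    (isFinitary_midEv _ _ _ _ _ _ _ (isFinitary_event _ _ _) (isFinitary_event _ _ _) (isFinitary_event _ _ _)
      (isFinitary_event _ _ _) (isFinitary_event _ _ _) isFinitary_univ (isFinitary_endX _ _ _ _))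
    (fun _ => by rw [midEv_xb]; exact singleton_mem_event_eq_one huv)
    (fun j j' _ _ hg => glMidS1_entry_closedU M x b w t z a τ i ha' j j' hg)
    (fun ω K₀ hF => ⟨fun j hj => ?_, fun j hj => ?_⟩) ?_
  · -- the exit witness of level `k` lies in the exit-line event
    obtain rfl := (jMidOpen_act_lo_iff M x b w t z a τ i i₀ hk ha true false j).1 hj
    rw [midEv_lo_five]
    have h5 := hF.conn_exit i i₀ hk ha
    unfold endX
    split_ifs with h0
    · rw [hw0 h0] at h5
      rw [event_comm, event_ge]
      exact mem_openConnGe_one_of_ne h5 huz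
    · rw [event_comm, event_ge]
      exact mem_openConnGe_zero_of_mem h5
  · -- the witnesses of level `k + 1` (slots `0`–`3` only) lie in the upgraded events
    have hj4 : (j : ℕ) < 4 := (jClosedU_act_up_iff M x b w t z a τ i ha' true false j).1 hj
    have hj5 : j ≠ 5 := by intro h; rw [h] at hj4; exact absurd hj4 (by decide)
    obtain ⟨h0, h1, h2, h3⟩ := hF.conn_closedU i ha'
    refine mem_midEv_up _ _ _ _ _ _ _ ?_ ?_ ?_ ?_ (Set.mem_univ _) j hj5
    · rw [event_ge]; exact mem_openConnGe_zero_of_mem h0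
    · rw [event_ge]
      exact mem_openConnGe_two_of_notMem h1 htz fun hm =>
        (hF.innerClass_two i hc2).2 (hF.witness_subset _ 1 hm)
    · rw [event_ge]; exact mem_openConnGe_one_of_ne h2 hty
    · rw [event_comm, event_ge]; exact mem_openConnGe_zero_of_mem h3
  · -- the two letters
    refine (prod_junF_le₂ p M x b w t z a τ i.castSucc glMidS1 true false _
      (show JIdx.xb ≠ JIdx.up 2 by decide)).trans (mul_le_mul' ?_ ?_)
    · -- `A^{κ,a,2,*}`: bond, `v → t`, `t ⇔ z`, exit of level `k`, on levels `k, k+1, k+1, k`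
      refine (junF_le_of_lines p M x b w t z a τ i.castSucc glMidS1 true false _ JIdx.xb
        ![JIdx.xb, .up 0, .up 1, .lo 5] (by decide) (fun m => ?_) ![0, 1, 1, 0] (fun m => by fin_cases m <;> rfl)
        ![event (eq 1) (b i.castSucc).1 (b i.castSucc).2, event (ge 0) (b i.castSucc).2 (t i.castSucc),
          event (ge 2) (t i.castSucc) (z i.castSucc), endX a₀ (b i.castSucc).1 (w i.castSucc) (z i.castSucc)]
        (by funext m; fin_cases m <;> rfl)).trans ?_
      · fin_cases m
        · exact ⟨rfl, rfl⟩
        · exact ⟨(jClosedU_act_up_iff M x b w t z a τ i ha' true false 0).2 (by decide), rfl⟩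
        · exact ⟨(jClosedU_act_up_iff M x b w t z a τ i ha' true false 1).2 (by decide), rfl⟩
        · exact ⟨(jMidOpen_act_lo_iff M x b w t z a τ i i₀ hk ha true false 5).2 rfl, rfl⟩
      · unfold endX
        split_ifs with h0
        · subst h0
          rw [hw0 rfl]
          exact piPerc_midS_zero_two_le_blockAiotaSt p hb hut.symm huz.symm _
        · obtain h1 | h2 : a₀ = 1 ∨ a₀ = 2 := by
            fin_cases a₀
            · exact absurd rfl h0
            · exact Or.inl rfl
            · exact Or.inr rfl
          · subst h1
            obtain ⟨κ', hκ'⟩ := (zdGraph_adj_iff_stepVec _ _).1 (hw1 rfl)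
            exact piPerc_midS_one_two_le_blockAiotaSt p hb hκ' _
          · subst h2
            exact piPerc_midS_two_two_le_blockAiotaSt p hb _
    · -- `A^{2,0}`: `t → u′`, `u′ → z` on level `k + 1`
      refine (junF_le_of_lines p M x b w t z a τ i.castSucc glMidS1 true false _ (JIdx.up 2)
        ![JIdx.up 2, .up 3] (by decide) (fun m => ?_) ![1, 1] (fun m => by fin_cases m <;> rfl)
        ![event (ge 1) (t i.castSucc) (b i.succ).1, event (ge 0) (b i.succ).1 (z i.castSucc)]
        (by funext m; fin_cases m <;> rfl)).trans ?_
      · fin_cases m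
        · exact ⟨(jClosedU_act_up_iff M x b w t z a τ i ha' true false 2).2 (by decide), rfl⟩
        · exact ⟨(jClosedU_act_up_iff M x b w t z a τ i ha' true false 3).2 (by decide), rfl⟩
      · exact piPerc_midS_two_zero_le_blockA p _

/-- **Cells `(a, 1, ★)`, `a ∈ {1,2}`, of a middle junction `k = i₀ + 1 ≤ M` whose successor junction is special**
(upper level `k + 1` closed): a package with target the `c = 1` summand
`A^{κ,a,1,*}(u_k,w_k,t_k,z_k) · A^{1,0}(t_k,z_k,u_{k+1},u_{k+1})` of the first term of (5.4) in the closed section.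
Inner class `1` makes the sausage line the open bond `{t ←1̲→ z}` itself and `z ~ t`; the closed canonical clause
with `t_k ≠ z_k` gives `t_k, z_k ≠ u_{k+1}`, so `{t ←1→ u_{k+1}}`, `{u_{k+1} ←1→ z}`.  (`a = 0` with `c = 1` is a
two-term row of a different shape, as in the open case, and is not treated here.)
[cite: FitznerVanDerHofstad2017, §6.1 (6.4), "Case a = 1 / a ≥ 2", "Case b = 1" (arXiv:1506.07977v2 pp. 58–59); §5.1 (5.4) (p. 48); (4.58), (4.62) (p. 41); App. B (pp. 74–75)] -/
theorem nonempty_jPkg_closedU_one (i i₀ : Fin (M + 1)) (hk : i₀.succ = i.castSucc) (κ : Fin d × Bool)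
    (hb : (b i.castSucc).2 = (b i.castSucc).1 + stepVec κ) (hc1 : (τ i).2 = 1)
    (a₀ : Fin 3) (ha : a i.castSucc = Sum.inl a₀) (ha0 : a₀ ≠ 0) {u₀ : Unit} (ha' : a i.succ = Sum.inr u₀) :
    Nonempty (JPkg p (jctx M x b w t z a τ i.castSucc) (JFacts M x b w t z a c τ)
      (blockAiotaSt (Letters.perc d p) κ a₀ 1 (b i.castSucc).1 (w i.castSucc) (t i.castSucc) (z i.castSucc) *
        blockA (Letters.perc d p) 1 0 (t i.castSucc) (z i.castSucc) (b i.succ).1 (b i.succ).1)) := by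
  -- degenerate parameters: the piece is empty
  by_cases hP : (zdGraph d).Adj (t i.castSucc) (z i.castSucc) ∧
      t i.castSucc ≠ (b i.succ).1 ∧ z i.castSucc ≠ (b i.succ).1 ∧
      (a₀ = 1 → (zdGraph d).Adj (b i.castSucc).1 (w i.castSucc))
  swap
  · refine ⟨JPkg.vacuous p _ _ (fun ω K₀ hF => hP ?_) _⟩
    have hadj := (hF.innerClass_one i hc1).2.2
    have hne := hF.ne_pin_closedU i ha' hadj.ne
    exact ⟨hadj, hne.2, hne.1, fun h1 => (hF.exitClass_one i.castSucc (ha.trans (by rw [h1]))).2.2⟩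
  obtain ⟨hadj, hty, hzy, hw1⟩ := hP
  have htz : t i.castSucc ≠ z i.castSucc := hadj.ne
  obtain ⟨κ', hκ'⟩ := (zdGraph_adj_iff_stepVec _ _).1 hadj
  have huv : (b i.castSucc).1 ≠ (b i.castSucc).2 := by
    rw [hb]; exact (zdGraph_adj_iff_stepVec _ _ |>.2 ⟨κ, rfl⟩).ne
  refine nonempty_jPkg_of_joint p i.castSucc glMidS1 true
    (midEv (event (eq 1) (b i.castSucc).1 (b i.castSucc).2) (event (ge 0) (b i.castSucc).2 (t i.castSucc))
      (event (eq 1) (t i.castSucc) (z i.castSucc)) (event (ge 1) (t i.castSucc) (b i.succ).1)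
      (event (ge 1) (b i.succ).1 (z i.castSucc)) Set.univ (event (ge 0) (z i.castSucc) (w i.castSucc)))
    (isFinitary_midEv _ _ _ _ _ _ _ (isFinitary_event _ _ _) (isFinitary_event _ _ _) (isFinitary_event _ _ _)
      (isFinitary_event _ _ _) (isFinitary_event _ _ _) isFinitary_univ (isFinitary_event _ _ _))
    (fun _ => by rw [midEv_xb]; exact singleton_mem_event_eq_one huv)
    (fun j j' _ _ hg => glMidS1_entry_closedU M x b w t z a τ i ha' j j' hg)
    (fun ω K₀ hF => ⟨fun j hj => ?_, fun j hj => ?_⟩) ?_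
  · -- the exit witness of level `k`
    obtain rfl := (jMidOpen_act_lo_iff M x b w t z a τ i i₀ hk ha true false j).1 hj
    rw [midEv_lo_five, event_comm, event_ge]
    exact mem_openConnGe_zero_of_mem (hF.conn_exit i i₀ hk ha)
  · -- the witnesses of level `k + 1` (slots `0`–`3`): the sausage witness is the open bond itself
    have hj4 : (j : ℕ) < 4 := (jClosedU_act_up_iff M x b w t z a τ i ha' true false j).1 hj
    have hj5 : j ≠ 5 := by intro h; rw [h] at hj4; exact absurd hj4 (by decide)
    obtain ⟨h0, -, h2, h3⟩ := hF.conn_closedU i ha'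
    have hK := hF.tz_witness_closedU i ha' htz (hF.innerClass_one i hc1).2.1
    refine mem_midEv_up _ _ _ _ _ _ _ ?_ ?_ ?_ ?_ (Set.mem_univ _) j hj5
    · rw [event_ge]; exact mem_openConnGe_zero_of_mem h0
    · rw [hK]; exact singleton_mem_event_eq_one htz
    · rw [event_ge]; exact mem_openConnGe_one_of_ne h2 hty
    · rw [event_comm, event_ge]; exact mem_openConnGe_one_of_ne h3 hzy
  · -- the two letters
    refine (prod_junF_le₂ p M x b w t z a τ i.castSucc glMidS1 true false _
      (show JIdx.xb ≠ JIdx.up 2 by decide)).trans (mul_le_mul' ?_ ?_)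
    · -- `A^{κ,a,1,*}`: bond, `v → t`, the open sausage bond, exit of level `k`
      refine (junF_le_of_lines p M x b w t z a τ i.castSucc glMidS1 true false _ JIdx.xb
        ![JIdx.xb, .up 0, .up 1, .lo 5] (by decide) (fun m => ?_) ![0, 1, 1, 0] (fun m => by fin_cases m <;> rfl)
        ![event (eq 1) (b i.castSucc).1 (b i.castSucc).2, event (ge 0) (b i.castSucc).2 (t i.castSucc),
          event (eq 1) (t i.castSucc) (z i.castSucc), event (ge 0) (z i.castSucc) (w i.castSucc)]
        (by funext m; fin_cases m <;> rfl)).trans ?_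
      · fin_cases m
        · exact ⟨rfl, rfl⟩
        · exact ⟨(jClosedU_act_up_iff M x b w t z a τ i ha' true false 0).2 (by decide), rfl⟩
        · exact ⟨(jClosedU_act_up_iff M x b w t z a τ i ha' true false 1).2 (by decide), rfl⟩
        · exact ⟨(jMidOpen_act_lo_iff M x b w t z a τ i i₀ hk ha true false 5).2 rfl, rfl⟩
      · obtain h1 | h2 : a₀ = 1 ∨ a₀ = 2 := by
          fin_cases a₀
          · exact absurd rfl ha0
          · exact Or.inl rfl
          · exact Or.inr rfl
        · subst h1
          obtain ⟨κ'', hκ''⟩ := (zdGraph_adj_iff_stepVec _ _).1 (hw1 rfl)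
          exact piPerc_midS_one_one_le_blockAiotaSt p hb hκ'' _
        · subst h2
          exact piPerc_midS_two_one_le_blockAiotaSt p hb _
    · -- `A^{1,0}`: `t → u′`, `u′ → z` on level `k + 1`, `z ~ t`
      refine (junF_le_of_lines p M x b w t z a τ i.castSucc glMidS1 true false _ (JIdx.up 2)
        ![JIdx.up 2, .up 3] (by decide) (fun m => ?_) ![1, 1] (fun m => by fin_cases m <;> rfl)
        ![event (ge 1) (t i.castSucc) (b i.succ).1, event (ge 1) (b i.succ).1 (z i.castSucc)]
        (by funext m; fin_cases m <;> rfl)).trans ?_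
      · fin_cases m
        · exact ⟨(jClosedU_act_up_iff M x b w t z a τ i ha' true false 2).2 (by decide), rfl⟩
        · exact ⟨(jClosedU_act_up_iff M x b w t z a τ i ha' true false 3).2 (by decide), rfl⟩
      · exact piPerc_midS_one_zero_le_blockA p hκ' _

end Packages

end Literature.Probability.FitznerVanDerHofstad2017
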